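import Summits.AtomisticToContinuum.Crystallization.Theorems.ChartedPlanarOrderRigidityDoor
import Summits.AtomisticToContinuum.Crystallization.Theorems.ChartedPlanarOrderCleanCovering

/-!
# ChartedPlanarOrder · N `ChartedZeroExcessLayered` (stmt-AtomisticToContinuum-26636) — `WindowCounting` IS PROVED
# (lens-3's TRUE·S/M piece of the «RigidityDoor» node, BY NAME; decomp-a2c, prover hand 1, generation 7)

`ChartedPlanarOrderRigidityDoor.WindowCounting` (landed text): for every hard core `δ > 0` and boundary width `r > 0` there are `C₂ ≥ 0` and `c₃ > 0`
such that every rooted `δ`-hard-core configuration that is `(1/16, 9/10, 1)`-two-shell CLEAN at every atom satisfies, for every `R ≥ 1`,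
(1) the `r`-boundary layer of the root's `R`-window has `≤ C₂ R²` atoms, and (2) every atom `p` of that window has `≥ c₃ R³` atoms in its own
`R`-window.

* §1 `card_shell_le` — SHELL PACKING (volume): `δ`-separated points in the shell `R − r < dist x 0 ≤ R` number at most
  `24 (1 + δ/2)² (r + δ) / δ³ · R²` for `R ≥ 1` (the `δ/2`-balls are disjoint, inside `B(0, R + δ/2)`, outside `B(0, R − r − δ/2)`).
* §2 `ncard_atomsIn_ge` — DENSITY FROM CLEANLINESS: by `ChartedPlanarOrderCleanCovering.exists_mem_dist_lt_five_of_clean` clean separated sets are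
  `5`-relatively dense, so a cubic grid of spacing `10` inside `B(p, R − 5)` labels distinct atoms of `B(p, R)`: `#atoms ≥ ⌊R/40⌋³ ≥ R³/512000`
  for `R ≥ 40`, and `≥ 1 ≥ R³/512000` below.
* §3 `windowCounting_holds : WindowCounting` with `C₂ = 24 (1 + δ/2)² (r + δ)/δ³`, `c₃ = 1/512000`.

No definitions, no `sorry`; `[folklore]` (volume packing and covering-to-density counting).
-/

noncomputable section

namespace Summit.AtomisticToContinuum.Crystallization.Theorems.ChartedPlanarOrderWindowCounting

open MeasureTheory Metric Set
open scoped BigOperators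
open Literature.Probability.Process
open Literature.Geometry.DiscreteGeometry
open Summit.AtomisticToContinuum.Crystallization.Theorems.ChartedPlanarOrderRigidityDoor
  (E3 matchedAt atomsIn bdryIn IsClean WindowCounting)
open Summit.AtomisticToContinuum.Crystallization.Theorems.ChartedPlanarOrderCleanCovering (exists_mem_dist_lt_five_of_clean)

/-! ## §1. Shell packing -/

/-- `a³ − b³ ≤ 3 a² (a − b)` for `0 ≤ b ≤ a`. [folklore] -/
theorem cube_sub_cube_le {a b : ℝ} (hb : 0 ≤ b) (hab : b ≤ a) : a ^ 3 - b ^ 3 ≤ 3 * a ^ 2 * (a - b) := by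
  nlinarith [mul_nonneg hb (sub_nonneg.2 hab), mul_nonneg (mul_nonneg hb hb) (sub_nonneg.2 hab), sq_nonneg (a - b)]

/-- **SHELL PACKING** (volume): a finite `δ`-separated set of points in the shell `R − r < dist x 0 ≤ R` (`R ≥ 1`, `δ > 0`, `r > 0`) has at most
`24 (1 + δ/2)² (r + δ)/δ³ · R²` elements. [folklore] -/
theorem card_shell_le {δ r R : ℝ} (hδ : 0 < δ) (hr : 0 < r) (hR : 1 ≤ R) (s : Finset (EuclideanSpace ℝ (Fin 3)))
    (hs : ∀ x ∈ s, R - r < dist x 0 ∧ dist x 0 ≤ R)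
    (hsd : ∀ x ∈ s, ∀ y ∈ s, x ≠ y → δ ≤ dist x y) :
    (s.card : ℝ) ≤ 24 * (1 + δ / 2) ^ 2 * (r + δ) / δ ^ 3 * R ^ 2 := by
  classical
  -- volumes
  set v1 : ℝ := (volume : Measure (EuclideanSpace ℝ (Fin 3))).real (ball 0 1) with hv1
  have hv1pos : 0 < v1 := ENNReal.toReal_pos (measure_ball_pos volume _ one_pos).ne' measure_ball_lt_top.ne
  have hvball : ∀ (c : EuclideanSpace ℝ (Fin 3)) (ρ : ℝ), 0 ≤ ρ →
      (volume : Measure (EuclideanSpace ℝ (Fin 3))).real (ball c ρ) = ρ ^ 3 * v1 := by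
    intro c ρ hρ
    rw [← Measure.addHaar_real_closedBall_eq_addHaar_real_ball volume c ρ, Measure.addHaar_real_closedBall volume c hρ,
      finrank_euclideanSpace_fin]
  set A : Set (EuclideanSpace ℝ (Fin 3)) := ⋃ c ∈ s, ball c (δ / 2) with hAdef
  have hdisj : Set.PairwiseDisjoint (↑s : Set (EuclideanSpace ℝ (Fin 3))) (fun c => ball c (δ / 2)) := by
    intro c hc d hd hcd
    apply ball_disjoint_ball
    have := hsd c hc d hd hcd
    linarith
  have hA : (volume : Measure (EuclideanSpace ℝ (Fin 3))).real A = (s.card : ℝ) * ((δ / 2) ^ 3 * v1) := by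
    rw [hAdef, measureReal_biUnion_finset hdisj fun c _ => measurableSet_ball]
    simp only [hvball _ (δ / 2) (by linarith), Finset.sum_const, nsmul_eq_mul]
  -- inner radius `b = max (R - r - δ/2) 0`, outer radius `R + δ/2`
  set b : ℝ := max (R - r - δ / 2) 0 with hb
  have hb0 : 0 ≤ b := le_max_right _ _
  have hρp : 0 ≤ R + δ / 2 := by linarith
  have hAsub : A ⊆ ball (0 : EuclideanSpace ℝ (Fin 3)) (R + δ / 2) := by
    refine Set.iUnion₂_subset fun c hc => ?_
    intro z hz
    rw [mem_ball] at hz ⊢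
    have h2 := dist_triangle z c 0
    have := (hs c hc).2
    linarith
  have hAin : Disjoint A (ball (0 : EuclideanSpace ℝ (Fin 3)) b) := by
    rw [Set.disjoint_left]
    intro z hzA hzB
    obtain ⟨c, hc, hzc⟩ := Set.mem_iUnion₂.1 hzA
    rw [mem_ball] at hzc hzB
    have h1 := (hs c hc).1
    have h2 := dist_triangle c z 0
    rw [dist_comm c z] at h2
    rcases lt_max_iff.1 hzB with h | h
    · linarith
    · exact absurd h (not_lt.2 dist_nonneg)
  have hU : (volume : Measure (EuclideanSpace ℝ (Fin 3))).real (A ∪ ball 0 b)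
      ≤ (volume : Measure (EuclideanSpace ℝ (Fin 3))).real (ball 0 (R + δ / 2)) :=
    measureReal_mono (Set.union_subset hAsub (ball_subset_ball (by
      rcases le_total (R - r - δ / 2) 0 with h | h
      · rw [hb, max_eq_right h]; linarith
      · rw [hb, max_eq_left h]; linarith)))
  have hAfin : (volume : Measure (EuclideanSpace ℝ (Fin 3))) A ≠ ⊤ :=
    ((measure_mono hAsub).trans_lt measure_ball_lt_top).ne
  rw [measureReal_union hAin measurableSet_ball hAfin, hA, hvball 0 _ hb0, hvball 0 _ hρp] at hU
  have hmain : (s.card : ℝ) * (δ / 2) ^ 3 + b ^ 3 ≤ (R + δ / 2) ^ 3 := by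
    have h' : ((s.card : ℝ) * (δ / 2) ^ 3 + b ^ 3) * v1 ≤ (R + δ / 2) ^ 3 * v1 := by nlinarith
    exact le_of_mul_le_mul_right h' hv1pos
  -- `(R + δ/2)³ − b³ ≤ 3 (R + δ/2)² (r + δ)` and `R + δ/2 ≤ (1 + δ/2) R`
  have hba : b ≤ R + δ / 2 := by
    rcases le_total (R - r - δ / 2) 0 with h | h
    · rw [hb, max_eq_right h]; linarith
    · rw [hb, max_eq_left h]; linarith
  have hgap : R + δ / 2 - b ≤ r + δ := by
    rcases le_total (R - r - δ / 2) 0 with h | h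
    · rw [hb, max_eq_right h]; linarith
    · rw [hb, max_eq_left h]; linarith
  have hcube := cube_sub_cube_le hb0 hba
  have h3 : (s.card : ℝ) * (δ / 2) ^ 3 ≤ 3 * (R + δ / 2) ^ 2 * (r + δ) := by
    have : 3 * (R + δ / 2) ^ 2 * (R + δ / 2 - b) ≤ 3 * (R + δ / 2) ^ 2 * (r + δ) :=
      mul_le_mul_of_nonneg_left hgap (by positivity)
    linarith
  have hRδ : (R + δ / 2) ^ 2 ≤ (1 + δ / 2) ^ 2 * R ^ 2 := by
    rw [← mul_pow]
    apply pow_le_pow_left₀ hρp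
    nlinarith
  have h4 : (s.card : ℝ) * (δ / 2) ^ 3 ≤ 3 * ((1 + δ / 2) ^ 2 * R ^ 2) * (r + δ) := by
    have hrd : 0 ≤ r + δ := by linarith
    have : 3 * (R + δ / 2) ^ 2 * (r + δ) ≤ 3 * ((1 + δ / 2) ^ 2 * R ^ 2) * (r + δ) := by nlinarith [hRδ]
    linarith
  have key : (s.card : ℝ) ≤ (3 * ((1 + δ / 2) ^ 2 * R ^ 2) * (r + δ)) / (δ / 2) ^ 3 := by
    rw [le_div_iff₀ (by positivity)]; exact h4
  calc (s.card : ℝ) ≤ (3 * ((1 + δ / 2) ^ 2 * R ^ 2) * (r + δ)) / (δ / 2) ^ 3 := key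
    _ = 24 * (1 + δ / 2) ^ 2 * (r + δ) / δ ^ 3 * R ^ 2 := by
      field_simp
      ring

/-! ## §2. Density from cleanliness (grid counting on the `5`-covering) -/

/-- the cubic grid vector with natural coordinates `(i, j, k)`. -/
theorem grid_apply (i j k : ℕ) (t : Fin 3) :
    (EuclideanSpace.single (0 : Fin 3) (i : ℝ) + EuclideanSpace.single (1 : Fin 3) (j : ℝ) + EuclideanSpace.single (2 : Fin 3) (k : ℝ) :
      EuclideanSpace ℝ (Fin 3)) t = if t = 0 then (i : ℝ) else if t = 1 then (j : ℝ) else (k : ℝ) := by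
  fin_cases t <;> simp

/-- norm of the grid vector is at most the sum of its (nonnegative) coordinates. [folklore] -/
theorem norm_grid_le (i j k : ℕ) :
    ‖(EuclideanSpace.single (0 : Fin 3) (i : ℝ) + EuclideanSpace.single (1 : Fin 3) (j : ℝ) + EuclideanSpace.single (2 : Fin 3) (k : ℝ) :
      EuclideanSpace ℝ (Fin 3))‖ ≤ i + j + k := by
  refine (norm_add_le _ _).trans (add_le_add ((norm_add_le _ _).trans (add_le_add ?_ ?_)) ?_) <;> simp

/-- distinct grid vectors are at distance `≥ 1`. [folklore] -/
theorem one_le_dist_grid {i j k i' j' k' : ℕ} (h : (i, j, k) ≠ (i', j', k')) :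
    1 ≤ dist (EuclideanSpace.single (0 : Fin 3) (i : ℝ) + EuclideanSpace.single (1 : Fin 3) (j : ℝ) + EuclideanSpace.single (2 : Fin 3) (k : ℝ) :
        EuclideanSpace ℝ (Fin 3))
      (EuclideanSpace.single (0 : Fin 3) (i' : ℝ) + EuclideanSpace.single (1 : Fin 3) (j' : ℝ) + EuclideanSpace.single (2 : Fin 3) (k' : ℝ)) := by
  set w : EuclideanSpace ℝ (Fin 3) :=
    EuclideanSpace.single (0 : Fin 3) (i : ℝ) + EuclideanSpace.single (1 : Fin 3) (j : ℝ) + EuclideanSpace.single (2 : Fin 3) (k : ℝ) with hw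
  set w' : EuclideanSpace ℝ (Fin 3) :=
    EuclideanSpace.single (0 : Fin 3) (i' : ℝ) + EuclideanSpace.single (1 : Fin 3) (j' : ℝ) + EuclideanSpace.single (2 : Fin 3) (k' : ℝ) with hw'
  -- a coordinate where they differ
  have hcoord : ∀ t : Fin 3, |(w - w') t| ≤ dist w w' := fun t => by
    rw [dist_eq_norm, ← Real.norm_eq_abs]
    exact PiLp.norm_apply_le (w - w') t
  have hint : ∀ a b : ℕ, a ≠ b → (1 : ℝ) ≤ |(a : ℝ) - (b : ℝ)| := by
    intro a b hab
    rcases lt_or_gt_of_ne hab with h | h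
    · have : (a : ℝ) + 1 ≤ b := by exact_mod_cast h
      rw [abs_of_neg (by linarith)]; linarith
    · have : (b : ℝ) + 1 ≤ a := by exact_mod_cast h
      rw [abs_of_pos (by linarith)]; linarith
  by_cases hi : i = i'
  · by_cases hj : j = j'
    · have hk : k ≠ k' := fun hk => h (by rw [hi, hj, hk])
      refine (hint k k' hk).trans (le_trans (le_of_eq ?_) (hcoord 2))
      simp only [hw, hw', PiLp.sub_apply, grid_apply]; simp
    · refine (hint j j' hj).trans (le_trans (le_of_eq ?_) (hcoord 1))
      simp only [hw, hw', PiLp.sub_apply, grid_apply]; simp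
  · refine (hint i i' hi).trans (le_trans (le_of_eq ?_) (hcoord 0))
    simp only [hw, hw', PiLp.sub_apply, grid_apply]; simp

/-- **DENSITY FROM CLEANLINESS**: in a `δ`-separated configuration that is `(1/16, 9/10, 1)`-two-shell good at every point, every atom `p` has at least
`R³/512000` atoms within distance `R` of it, for every `R ≥ 1`. [folklore] -/
theorem ncard_atomsIn_ge {S : Set (EuclideanSpace ℝ (Fin 3))} {δ : ℝ} (hδ : 0 < δ)
    (hsep : ∀ x ∈ S, ∀ y ∈ S, x ≠ y → δ ≤ dist x y)
    (hclean : ∀ q ∈ S, IsTwoShellGoodSet (1 / 16) (9 / 10) 1 S q) {p : EuclideanSpace ℝ (Fin 3)} (hp : p ∈ S)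
    {R : ℝ} (hR : 1 ≤ R) :
    (1 : ℝ) / 512000 * R ^ 3 ≤ (Set.ncard (atomsIn ((Measure.count : Measure E3).restrict S) p R) : ℝ) := by
  classical
  set K : Set E3 := atomsIn ((Measure.count : Measure E3).restrict S) p R with hK
  have hKS : ∀ q, q ∈ K ↔ q ∈ S ∧ dist q p ≤ R := fun q => by
    simp only [hK, atomsIn, mem_setOf_eq, count_restrict_singleton_ne_zero_iff]
  have hKfin : K.Finite := by
    refine (LocalConfig.finite_inter_of_separated hδ hsep (isCompact_closedBall p R)).subset fun q hq => ?_
    exact ⟨mem_closedBall.2 ((hKS q).1 hq).2, ((hKS q).1 hq).1⟩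
  have hpK : p ∈ K := (hKS p).2 ⟨hp, by rw [dist_self]; linarith⟩
  have hK1 : (1 : ℝ) ≤ (Set.ncard K : ℝ) := by
    have : 0 < Set.ncard K := (Set.ncard_pos hKfin).2 ⟨p, hpK⟩
    exact_mod_cast this
  by_cases hR40 : R < 40
  · -- small windows: the atom itself suffices
    have : (1 : ℝ) / 512000 * R ^ 3 ≤ 1 := by
      have hR3 : R ^ 3 < 40 ^ 3 := by
        have h0 : 0 ≤ R := by linarith
        nlinarith [mul_nonneg h0 h0]
      nlinarith
    exact this.trans hK1
  rw [not_lt] at hR40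
  -- the grid of spacing `10` with `m = ⌊R/40⌋` points per axis
  set m : ℕ := ⌊R / 40⌋₊ with hm
  have hm1 : 1 ≤ m := Nat.le_floor (by rw [Nat.cast_one]; linarith [div_le_div_of_nonneg_right hR40 (by norm_num : (0:ℝ) ≤ 40)])
  have hmle : (m : ℝ) ≤ R / 40 := Nat.floor_le (by positivity)
  have hmge : R / 80 ≤ (m : ℝ) := by
    by_cases hR80 : R < 80
    · have : (1 : ℝ) ≤ m := by exact_mod_cast hm1
      linarith
    · rw [not_lt] at hR80
      have := Nat.lt_floor_add_one (R / 40)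
      rw [← hm] at this
      linarith
  -- grid points and their atoms
  let z : Fin m × Fin m × Fin m → EuclideanSpace ℝ (Fin 3) := fun ijk =>
    p + (10 : ℝ) • (EuclideanSpace.single (0 : Fin 3) ((ijk.1 : ℕ) : ℝ) + EuclideanSpace.single (1 : Fin 3) ((ijk.2.1 : ℕ) : ℝ) +
      EuclideanSpace.single (2 : Fin 3) ((ijk.2.2 : ℕ) : ℝ))
  have hcov : ∀ ijk, ∃ a ∈ S, dist a (z ijk) < 5 := fun ijk =>
    exists_mem_dist_lt_five_of_clean hδ hsep ⟨p, hp⟩ hclean (z ijk)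
  choose a haS haz using hcov
  -- the grid stays inside `B(p, R − 5)`
  have hzp : ∀ ijk, dist (z ijk) p ≤ R - 25 := by
    intro ijk
    obtain ⟨i, j, k⟩ := ijk
    have hi : ((i : ℕ) : ℝ) + 1 ≤ m := by exact_mod_cast i.2
    have hj : ((j : ℕ) : ℝ) + 1 ≤ m := by exact_mod_cast j.2
    have hk : ((k : ℕ) : ℝ) + 1 ≤ m := by exact_mod_cast k.2
    show dist (p + (10 : ℝ) • _) p ≤ R - 25
    rw [dist_eq_norm, add_sub_cancel_left, norm_smul, Real.norm_eq_abs, abs_of_pos (by norm_num : (0:ℝ) < 10)]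
    have := norm_grid_le (i : ℕ) (j : ℕ) (k : ℕ)
    nlinarith
  have haK : ∀ ijk, a ijk ∈ K := fun ijk => (hKS _).2 ⟨haS ijk, by
    have h1 := haz ijk
    have h2 := hzp ijk
    have := dist_triangle (a ijk) (z ijk) p
    linarith⟩
  -- distinct grid points label distinct atoms
  have hinj : Function.Injective a := by
    intro x y hxy
    by_contra hne
    obtain ⟨i, j, k⟩ := x
    obtain ⟨i', j', k'⟩ := y
    have hne' : ((i : ℕ), (j : ℕ), (k : ℕ)) ≠ ((i' : ℕ), (j' : ℕ), (k' : ℕ)) := by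
      intro h
      simp only [Prod.mk.injEq] at h
      exact hne (Prod.ext (Fin.ext h.1) (Prod.ext (Fin.ext h.2.1) (Fin.ext h.2.2)))
    have hgrid := one_le_dist_grid hne'
    have hzz : (10 : ℝ) ≤ dist (z (i, j, k)) (z (i', j', k')) := by
      show (10 : ℝ) ≤ dist (p + (10 : ℝ) • _) (p + (10 : ℝ) • _)
      rw [dist_eq_norm, add_sub_add_left_eq_sub, ← smul_sub, norm_smul, Real.norm_eq_abs, abs_of_pos (by norm_num : (0:ℝ) < 10),
        ← dist_eq_norm]
      linarith
    have h1 := haz (i, j, k)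
    have h2 := haz (i', j', k')
    rw [hxy] at h1
    have := dist_triangle (z (i, j, k)) (a (i', j', k')) (z (i', j', k'))
    rw [dist_comm (z (i, j, k)) (a (i', j', k'))] at this
    linarith
  -- count
  have hrange : Set.range a ⊆ K := by rintro _ ⟨ijk, rfl⟩; exact haK ijk
  have hcard : (Set.range a).ncard = m * (m * m) := by
    rw [Set.ncard_range_of_injective hinj, Nat.card_prod, Nat.card_prod]
    simp
  have hle : m * (m * m) ≤ Set.ncard K := by
    rw [← hcard]; exact Set.ncard_le_ncard hrange hKfin
  have hle' : ((m : ℝ)) ^ 3 ≤ (Set.ncard K : ℝ) := by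
    have : ((m * (m * m) : ℕ) : ℝ) ≤ (Set.ncard K : ℝ) := by exact_mod_cast hle
    calc ((m : ℝ)) ^ 3 = ((m * (m * m) : ℕ) : ℝ) := by push_cast; ring
      _ ≤ _ := this
  have hm3 : (R / 80) ^ 3 ≤ (m : ℝ) ^ 3 := pow_le_pow_left₀ (by positivity) hmge 3
  calc (1 : ℝ) / 512000 * R ^ 3 = (R / 80) ^ 3 := by ring
    _ ≤ (m : ℝ) ^ 3 := hm3
    _ ≤ _ := hle'

/-! ## §3. `WindowCounting` by name -/

/-- **lens-3's TRUE piece `WindowCounting` of the «RigidityDoor» node (landed text, BY NAME)**, with `C₂ = 24 (1 + δ/2)² (r + δ)/δ³` and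
`c₃ = 1/512000`. [folklore] -/
theorem windowCounting_holds : WindowCounting := by
  classical
  intro δ hδ r hr
  refine ⟨24 * (1 + δ / 2) ^ 2 * (r + δ) / δ ^ 3, by positivity, (1 : ℝ) / 512000, by norm_num, ?_⟩
  intro μ hμ hclean R hR
  obtain ⟨S, h0, hsep, rfl⟩ := hμ
  have hq : ∀ q : E3, ((Measure.count : Measure E3).restrict S) {q} ≠ 0 ↔ q ∈ S :=
    count_restrict_singleton_ne_zero_iff S
  have hSset : {q : EuclideanSpace ℝ (Fin 3) | ((Measure.count : Measure E3).restrict S) {q} ≠ 0} = S := by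
    ext q; exact hq q
  have hclean' : ∀ q ∈ S, IsTwoShellGoodSet (1 / 16) (9 / 10) 1 S q := by
    intro q hqS
    have h := hclean q ((hq q).2 hqS)
    rwa [hSset] at h
  refine ⟨?_, fun p hp _ => ncard_atomsIn_ge hδ hsep hclean' ((hq p).1 hp) hR⟩
  -- the boundary layer lies in the shell `R − r < dist x 0 ≤ R`
  set B : Set E3 := bdryIn r ((Measure.count : Measure E3).restrict S) (atomsIn ((Measure.count : Measure E3).restrict S) 0 R) with hB
  have hBmem : ∀ x, x ∈ B → x ∈ S ∧ R - r < dist x 0 ∧ dist x 0 ≤ R := by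
    intro x hx
    simp only [hB, bdryIn, atomsIn, mem_setOf_eq, hq, not_and, not_le] at hx
    obtain ⟨⟨hxS, hxR⟩, y, hyS, hyR, hxy⟩ := hx
    refine ⟨hxS, ?_, hxR⟩
    have hy := hyR hyS
    have := dist_triangle y x 0
    rw [dist_comm y x] at this
    linarith
  have hBfin : B.Finite :=
    (LocalConfig.finite_inter_of_separated hδ hsep (isCompact_closedBall (0 : E3) R)).subset fun x hx =>
      ⟨mem_closedBall.2 (hBmem x hx).2.2, (hBmem x hx).1⟩
  rw [Set.ncard_eq_toFinset_card _ hBfin]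
  refine card_shell_le hδ hr hR hBfin.toFinset (fun x hx => ?_) (fun x hx y hy hxy => ?_)
  · exact (hBmem x (hBfin.mem_toFinset.1 hx)).2
  · exact hsep x (hBmem x (hBfin.mem_toFinset.1 hx)).1 y (hBmem y (hBfin.mem_toFinset.1 hy)).1 hxy

end Summit.AtomisticToContinuum.Crystallization.Theorems.ChartedPlanarOrderWindowCounting

end
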